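import Summits.BirchSwinnertonDyer.BirchSwinnertonDyer.Theorems.ByReductionTypeAtTwoOrdEisensteinHalfShaAlgebra
import Summits.BirchSwinnertonDyer.BirchSwinnertonDyer.Theorems.ByReductionTypeAtTwoOrdEisensteinHalfEquivalence
import Summits.BirchSwinnertonDyer.Rank1Residual.X2.AnalyticInvariants
import HarnessLib

/-!
# The Eisenstein half of the `2`-adic main conjecture in `Ш`-currency, II: the rank-`0` dictionary and
# Kato's readings at a cyclotomic datum (route ByReductionTypeAtTwo / TwoAdicConverse, crux
# `OrdEisensteinHalfAtTwo`, item stmt-BirchSwinnertonDyer-19272; seat bsd-2adic-ord-3, GEN 2)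

HONEST FRAMING (cell `bsd-2adic`, HUMAN RULINGS D-0036/D-0074): THEOREMS ONLY — no definition, no named
fact, nothing asserted, closes nothing; every PUBLISHED input (Kato 2004 Thm. 17.4 (1)(2) AT `2`,
Greenberg 1999 Thm. 4.1 AT `2` = `X5.O1.TwoAdicEulerCharRankZero W 0`, Gross–Zagier–Kolyvagin) enters
as a displayed hypothesis, exactly as in the sibling files of this route.

WHAT IS PROVED.
* §2 `exists_shaAn_eq_and_valuation_constantCoeff_charGen_eq` — the DICTIONARY on a rank-`0`
  good-ordinary-at-`2` curve: for a cyclotomic datum `D` with `X` torsion and generator `f_X` of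
  `char_Λ X`, the Néron ratio `ϖ` and ANY `L₀ ∈ Λ` with `ι L₀ = ϖ′·L₂(f,α)` (`ϖ′ ∈ ℚˣ`):
  `ord₂ f_X(0) + ord₂ #Ш_an + ord₂ ϖ′ = ord₂ L₀(0) + ord₂ #Ш + ord₂ ϖ` (Thm. 4.1 at `2` +
  Mazur–Tate–Teitelbaum interpolation + Miller's `#Ш_an`; the bookkeeping of
  `X5.O1.lowerBound_two_of_eisensteinDivisibility`, isolated as an identity).
* §3 `sha_readings_of_kato` — with Kato 17.4 (1)(2) AT `2` pulled back to `Λ`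
  (`MuZeroUpgrade.exists_mul_charGen_eq_of_kato_allPrimes`) and file I: (i)
  `ord₂ #Ш + μ(L₀) + ord₂ ϖ ≤ ord₂ #Ш_an + ord₂ ϖ′ + μ(X)`; (ii) `λ(L₀) ≤ λ(X)` IFF
  `ord₂ #Ш_an + ord₂ ϖ′ + μ(X) ≤ ord₂ #Ш + μ(L₀) + ord₂ ϖ`; (iii) `λ(X) ≤ λ(L₀)`. Corollary (A)
  `padicValNat_shaOrder_add_mu_le_of_kato`: at the Néron normalisation,
  `ord₂ #Ш(E) + μ(L₀) ≤ ord₂ #Ш_an(E) + μ(X(E/ℚ_∞))` — Kato's rational divisibility bounds `Ш[2^∞]` from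
  ABOVE with defect EXACTLY `μ(X) − μ(L₀)` (PUB only; with `μ(X) = 0` the sharp `MissingUpperBoundAt`).

So the «transcendental» inequality `λ_an ≤ λ(X)` of the crux is, on rank-`0` curves, an inequality
between `#Ш(E)[2^∞]` (a ℚ-DESCENT quantity at layer `0`), `#Ш_an(E)` and the two `μ`-invariants; the
sequel `…ShaCurrency.lean` turns this into the certificate doors. Nothing about rank `≥ 1` here.

References: K. Kato, Astérisque 295 (2004), Thm. 17.4 (1)(2) (p. 273); R. Greenberg, LNM 1716 (1999),
Thm. 4.1 (p. 102); B. Mazur, J. Tate, J. Teitelbaum, Invent. Math. 84 (1986), §I.14; R. L. Miller, LMS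
J. Comput. Math. 14 (2011), Def. 1.1; D. Rohrlich, Invent. Math. 75 (1984).
-/

set_option autoImplicit false

noncomputable section

open scoped Classical MatrixGroups ModularForm

open CongruenceSubgroup WeierstrassCurve Literature.NumberTheory.EllipticCurves
  Literature.NumberTheory.EllipticCurves.ModularForms Literature.NumberTheory.EllipticCurves.Rank1Residual
  Literature.NumberTheory.EllipticCurves.Rank1Residual.Typed
  Summit.BirchSwinnertonDyer.Rank1Residual.X1.MuLambda
  Summit.BirchSwinnertonDyer.Rank1Residual.X1.MuPart
  Summit.BirchSwinnertonDyer.Rank1Residual.X1.ParitySqueeze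

namespace Summit.BirchSwinnertonDyer.BirchSwinnertonDyer.Theorems.EisensteinShaCurrency

/-! ## §2 The rank-`0` dictionary at `p = 2`: `ord₂ f_X(0) − ord₂ L₀(0) = ord₂ #Ш − ord₂ #Ш_an + ord₂ ϖ − ord₂ ϖ′` -/

section Dictionary

open Literature.NumberTheory.EllipticCurves.Wuthrich2014
  Summit.BirchSwinnertonDyer.Rank1Residual Summit.BirchSwinnertonDyer.Rank1Residual.X5

variable (W : WeierstrassCurve ℚ) [W.IsElliptic] [W.IsGloballyMinimal]

/-- **The rank-`0` dictionary between the constant terms and `Ш` (PROVED bookkeeping).** `E = W`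
globally minimal, good ordinary at `2`, `L(E,1) ≠ 0`; PUBLISHED inputs as hypotheses: Greenberg's
Thm. 4.1 AT `2` (`hEC`, slot `δ = 0`) and Gross–Zagier–Kolyvagin (`hGZK`: `E(ℚ)`, `Ш` finite,
`#Ш_an = (L(E,1)/Ω_E)·#E(ℚ)²/∏c_ℓ`). Fix a cyclotomic datum `(κ, γ, D)` with `X` torsion (`hX`), a
newform `f` of `E`, the Néron ratio `ϖ` (`ϖ·Ω_E = Ω⁺_f`), a generator `f_X` of `char_Λ X`, and ANY
non-zero rational `ϖ′` with an integral `L₀ ∈ Λ`, `ι L₀ = ϖ′·L₂(f, α)`. Then `#Ш_an = q ∈ ℚˣ`,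
`f_X(0) ≠ 0`, `L₀(0) ≠ 0` and
`ord₂ f_X(0) + ord₂ q + ord₂ ϖ′ = ord₂ L₀(0) + ord₂ #Ш + ord₂ ϖ`, i.e.
`ord₂ f_X(0) − ord₂ L₀(0) = (ord₂ #Ш − ord₂ #Ш_an) − (ord₂ ϖ′ − ord₂ ϖ)`. Proof: Thm. 4.1 gives
`f_X(0)·#E(ℚ)(2)² ~ 2^{ord₂ ∏c}·#Ẽ(𝔽₂)(2)²·#Sel_{2^∞}(E/ℚ)`, interpolation gives
`L₀(0) = ϖ′·(1 − α⁻¹)²·[0]⁺_f` with `1 − α⁻¹ ~ #Ẽ(𝔽₂)(2)`, `#Sel = #Ш(2)`, and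
`#Ш_an = ϖ·[0]⁺_f·#E(ℚ)_tors²/∏c_ℓ`. [cite: GreenbergLNM1716, Thm. 4.1 (p. 102)]
[cite: MazurTateTeitelbaum1986Invent, §I.14 (14.3)] [cite: Miller2011LMS, Def. 1.1 and §1] -/
theorem exists_shaAn_eq_and_valuation_constantCoeff_charGen_eq
    (hEC : O1.TwoAdicEulerCharRankZero W 0) (hGZK : rank_eq_analyticRank_of_analyticRank_le_one)
    (hord : IsOrdinaryAt W 2) (hL : W.entireLFunction 1 ≠ 0)
    {κ : ZpExtension ℚ 2} {γ : Field.absoluteGaloisGroup ℚ} {N : ℕ} [NeZero N]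
    {f : CuspForm (Gamma0 N) 2} (hκ : κ.IsCyclotomic) (hγ : κ.IsTopGenerator γ)
    (hγ' : IsCyclotomicVariable 2 γ) (hf : IsNewformOf W f) (D : W.SelmerDualData κ γ)
    (hX : D.IsTorsion) {ϖ : ℚ} (hϖ : (ϖ : ℝ) * W.realPeriodRat = plusPeriod f) {ϖ' : ℚ}
    (hϖ'0 : ϖ' ≠ 0) {fX : IwasawaAlgebra 2} (hchar : D.charIdeal = Ideal.span {fX})
    {L₀ : IwasawaAlgebra 2}
    (hL₀ : iwasawaToPowerSeries 2 L₀ =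
      PowerSeries.C (ϖ' : ℚ_[2]) * padicLFunction f (unitRoot W 2 : ℚ_[2])) :
    ∃ q : ℚ, shaAn W = (q : ℂ) ∧ q ≠ 0 ∧ PowerSeries.constantCoeff fX ≠ 0 ∧
      PowerSeries.constantCoeff L₀ ≠ 0 ∧
      ((PowerSeries.constantCoeff fX).valuation : ℤ) + padicValRat 2 q + padicValRat 2 ϖ' =
        ((PowerSeries.constantCoeff L₀).valuation : ℤ) + (padicValNat 2 W.shaOrder : ℤ) +
          padicValRat 2 ϖ := by
  -- Step 0: `t = ϖ · s = L(E,1)/Ω_E`, `s = [0]⁺_f ≠ 0`, `ϖ ≠ 0`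
  have hΩpos : 0 < W.realPeriodRat := W.realPeriodRat_pos_holds
  have hϖ0 : ϖ ≠ 0 := by
    rintro rfl
    have hper : 0 < plusPeriod f := IsNewform0.plusPeriod_pos_holds hf.1 hf.coeffField_eq_bot
    rw [← hϖ, Rat.cast_zero, zero_mul] at hper
    exact lt_irrefl _ hper
  set s : ℚ := ratPlusSymbol f 0 with hs_def
  set t : ℚ := ϖ * s with ht_def
  have hLval : W.entireLFunction 1 = (((s : ℝ) * plusPeriod f : ℝ) : ℂ) := hf.entireLFunction_one_eq
  have hq : W.entireLFunction 1 / (W.realPeriodRat : ℂ) = ((t : ℚ) : ℂ) := by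
    rw [hLval, ← hϖ, div_eq_iff (Complex.ofReal_ne_zero.mpr hΩpos.ne'), ht_def]
    push_cast
    ring
  have hs0 : s ≠ 0 := by
    intro h0
    apply hL
    rw [hLval, h0]
    simp
  have ht0 : t ≠ 0 := mul_ne_zero hϖ0 hs0
  -- Step 1: finiteness from GZK (rank 0): `E(ℚ)`, `Ш`, `Sel_{2^∞}(E/ℚ)` finite
  obtain ⟨-, hE, hfin, hshaAn⟩ := shaAn_eq_of_L_one_div_eq hGZK W hL hq
  haveI := hE
  haveI : Finite W.sha := hfin
  have hShapfin : Finite (AddCommGroup.primaryComponent W.sha 2) :=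
    Finite.of_injective _ Subtype.val_injective
  have hSelfin : Finite (W.selmerGroupPInfty 2) :=
    (W.finite_selmerGroupPInfty_iff 2).mpr ⟨hE, hShapfin⟩
  haveI := hSelfin
  haveI : Module.Finite (IwasawaAlgebra 2) D.X := D.module_finite_holds hγ
  -- Step 2 (interpolation): `L₀(0) = ϖ′ · (1 - α⁻¹)² · s`
  set a : ℚ_[2] := ((unitRoot W 2 : ℤ_[2]) : ℚ_[2]) with ha
  have hL00Q : ((PowerSeries.constantCoeff L₀ : ℤ_[2]) : ℚ_[2]) =
      (ϖ' : ℚ_[2]) * ((1 - a⁻¹) ^ 2 * (s : ℚ_[2])) := by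
    rw [← constantCoeff_iwasawaToPowerSeries 2 L₀, hL₀, map_mul, PowerSeries.constantCoeff_C,
      constantCoeff_padicLFunction_unitRoot hord hf]
  -- bridges `1 - α⁻¹ = u₂ · #Ẽ(𝔽₂)`, `#Ẽ(𝔽₂) = u₃ · #Ẽ(𝔽₂)(2)`
  obtain ⟨u₂, hu₂⟩ := exists_unit_one_sub_unitRoot_inv 2 W hord
  haveI : NeZero (2 : ℕ) := ⟨two_ne_zero⟩
  obtain ⟨u₃, hu₃⟩ := exists_unit_natCard_eq_mul_card_primaryComponent
    ((integralModelInt W).map (Int.castRingHom (ZMod 2))).toAffine.Point 2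
  set Np : ℚ_[2] := (Nat.card (AddCommGroup.primaryComponent
    ((integralModelInt W).map (Int.castRingHom (ZMod 2))).toAffine.Point 2) : ℚ_[2]) with hNp
  have hNcount : (W.reductionPointCount 2 : ℚ_[2]) = ((u₃ : ℤ_[2]) : ℚ_[2]) * Np := by
    rw [WeierstrassCurve.reductionPointCount, hNp]
    exact hu₃
  have hNp0 : Np ≠ 0 := by
    rw [hNp]
    exact_mod_cast Nat.card_pos.ne'
  have h1 : (1 - a⁻¹) = ((u₂ : ℤ_[2]) : ℚ_[2]) * ((u₃ : ℤ_[2]) : ℚ_[2]) * Np := by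
    rw [hu₂, hNcount, mul_assoc]
  have hsQ0 : (s : ℚ_[2]) ≠ 0 := by exact_mod_cast hs0
  have hϖ'Q0 : (ϖ' : ℚ_[2]) ≠ 0 := by exact_mod_cast hϖ'0
  have hU0 : ((u₂ : ℤ_[2]) : ℚ_[2]) * ((u₃ : ℤ_[2]) : ℚ_[2]) ≠ 0 :=
    mul_ne_zero (coe_units_ne_zero 2 u₂) (coe_units_ne_zero 2 u₃)
  have h1a0 : (1 - a⁻¹) ≠ 0 := by rw [h1]; exact mul_ne_zero hU0 hNp0
  have h20 : (2 : ℚ_[2]) ≠ 0 := two_ne_zero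
  have hL00 : PowerSeries.constantCoeff L₀ ≠ 0 := by
    intro h0
    have : ((PowerSeries.constantCoeff L₀ : ℤ_[2]) : ℚ_[2]) = 0 := by rw [h0]; rfl
    rw [hL00Q] at this
    exact mul_ne_zero hϖ'Q0 (mul_ne_zero (pow_ne_zero 2 h1a0) hsQ0) this
  -- Step 3 (Greenberg's Thm. 4.1 AT 2, hypothesis `hEC`, slot `δ = 0`, for the generator `f_X`)
  obtain ⟨u₁, hu₁⟩ := hEC hord κ γ hκ hγ hγ' D hX fX hchar hSelfin
  rw [add_zero, zpow_natCast] at hu₁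
  -- Step 4 (the remaining bridges)
  obtain ⟨u₄, hu₄⟩ := exists_unit_torsionOrder_eq W 2
  obtain ⟨u₅, hu₅⟩ := exists_unit_natCard_eq_mul_card_primaryComponent W.sha 2
  have hSel : Nat.card (W.selmerGroupPInfty 2) = Nat.card (AddCommGroup.primaryComponent W.sha 2) :=
    W.natCard_selmerGroupPInfty_eq_natCard_primaryComponent_sha 2
  set v := padicValNat 2 W.tamagawaProduct with hv
  set Tp : ℚ_[2] := (Nat.card (AddCommGroup.primaryComponent W.toAffine.Point 2) : ℚ_[2]) with hTp
  set Shp : ℚ_[2] := (Nat.card (AddCommGroup.primaryComponent W.sha 2) : ℚ_[2]) with hShp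
  have hu₄' : (W.torsionOrder : ℚ_[2]) = ((u₄ : ℤ_[2]) : ℚ_[2]) * Tp := by
    rw [hu₄, hTp]
    congr 1
    exact_mod_cast natCard_primaryComponent_point_congr W 2 _ _
  have hSha : (W.shaOrder : ℚ_[2]) = ((u₅ : ℤ_[2]) : ℚ_[2]) * Shp := by
    rw [WeierstrassCurve.shaOrder, hShp]
    exact hu₅
  have hSel' : (Nat.card (W.selmerGroupPInfty 2) : ℚ_[2]) = Shp := by rw [hShp, hSel]
  have hTp0 : Tp ≠ 0 := by rw [hTp]; exact_mod_cast Nat.card_pos.ne'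
  have hShp0 : Shp ≠ 0 := by rw [hShp]; exact_mod_cast Nat.card_pos.ne'
  rw [hSel'] at hu₁
  -- `f_X(0) ≠ 0` (the right-hand side of Thm. 4.1 is non-zero)
  have hfX0Q : ((PowerSeries.constantCoeff fX : ℤ_[2]) : ℚ_[2]) ≠ 0 := by
    intro h0'
    have := hu₁
    rw [h0', zero_mul] at this
    exact (mul_ne_zero (mul_ne_zero (mul_ne_zero (coe_units_ne_zero 2 u₁) (pow_ne_zero v h20))
      (pow_ne_zero 2 hNp0)) hShp0) this.symm
  have hfX0 : PowerSeries.constantCoeff fX ≠ 0 := by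
    intro h0
    exact hfX0Q (by rw [h0]; rfl)
  -- Step 5: valuations
  have hv2 : (2 : ℚ_[2]).valuation = 1 := by
    have h2 : ((2 : ℕ) : ℚ_[2]).valuation = 1 := Padic.valuation_p
    rwa [Nat.cast_ofNat] at h2
  have hvT : Tp.valuation = (padicValNat 2 W.torsionOrder : ℤ) := by
    have h := congrArg Padic.valuation hu₄'
    rw [Padic.valuation_natCast, Padic.valuation_mul (coe_units_ne_zero 2 u₄) hTp0,
      valuation_coe_units_eq_zero, zero_add] at h
    exact h.symm
  have hvS : Shp.valuation = (padicValNat 2 W.shaOrder : ℤ) := by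
    have h := congrArg Padic.valuation hSha
    rw [Padic.valuation_natCast, Padic.valuation_mul (coe_units_ne_zero 2 u₅) hShp0,
      valuation_coe_units_eq_zero, zero_add] at h
    exact h.symm
  -- `ord₂ f_X(0) + 2·tors = v + 2·ord₂ Np + sha`
  have hvalfX : ((PowerSeries.constantCoeff fX).valuation : ℤ) +
      2 * (padicValNat 2 W.torsionOrder : ℤ) = v + 2 * Np.valuation + (padicValNat 2 W.shaOrder : ℤ) := by
    have h := congrArg Padic.valuation hu₁
    rw [Padic.valuation_mul hfX0Q (pow_ne_zero 2 hTp0), Padic.valuation_pow,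
      Padic.valuation_mul (mul_ne_zero (mul_ne_zero (coe_units_ne_zero 2 u₁) (pow_ne_zero v h20))
        (pow_ne_zero 2 hNp0)) hShp0,
      Padic.valuation_mul (mul_ne_zero (coe_units_ne_zero 2 u₁) (pow_ne_zero v h20))
        (pow_ne_zero 2 hNp0),
      Padic.valuation_mul (coe_units_ne_zero 2 u₁) (pow_ne_zero v h20), valuation_coe_units_eq_zero,
      Padic.valuation_pow, Padic.valuation_pow, hv2, hvT, hvS, PadicInt.valuation_coe] at h
    push_cast at h ⊢
    linarith
  -- `ord₂ L₀(0) = ord₂ ϖ′ + 2·ord₂ Np + ord₂ s`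
  have hvalL₀ : ((PowerSeries.constantCoeff L₀).valuation : ℤ) =
      padicValRat 2 ϖ' + 2 * Np.valuation + padicValRat 2 s := by
    have h := congrArg Padic.valuation hL00Q
    rw [PadicInt.valuation_coe, Padic.valuation_mul hϖ'Q0 (mul_ne_zero (pow_ne_zero 2 h1a0) hsQ0),
      Padic.valuation_mul (pow_ne_zero 2 h1a0) hsQ0, Padic.valuation_pow, h1,
      Padic.valuation_mul hU0 hNp0,
      Padic.valuation_mul (coe_units_ne_zero 2 u₂) (coe_units_ne_zero 2 u₃),
      valuation_coe_units_eq_zero, valuation_coe_units_eq_zero, Padic.valuation_ratCast,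
      Padic.valuation_ratCast] at h
    push_cast at h ⊢
    linarith
  -- Step 6: Miller's currency `#Ш_an = t · #E(ℚ)² / ∏ c_ℓ`
  have hcard : (Nat.card W.toAffine.Point : ℚ) ≠ 0 := by
    exact_mod_cast (Nat.card_pos (α := W.toAffine.Point)).ne'
  have htam : (W.tamagawaProduct : ℚ) ≠ 0 := by
    exact_mod_cast (W.tamagawaProduct_pos_holds : 0 < W.tamagawaProduct).ne'
  have hcardT : (Nat.card W.toAffine.Point : ℚ) = (W.torsionOrder : ℚ) := by
    exact_mod_cast (W.torsionOrder_eq_natCard_of_finite).symm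
  have hq0 : t * (Nat.card W.toAffine.Point : ℚ) ^ 2 / (W.tamagawaProduct : ℚ) ≠ 0 :=
    div_ne_zero (mul_ne_zero ht0 (pow_ne_zero 2 hcard)) htam
  have hvq : padicValRat 2 (t * (Nat.card W.toAffine.Point : ℚ) ^ 2 / (W.tamagawaProduct : ℚ)) =
      padicValRat 2 ϖ + padicValRat 2 s + 2 * (padicValNat 2 W.torsionOrder : ℤ) - v := by
    rw [padicValRat.div (mul_ne_zero ht0 (pow_ne_zero 2 hcard)) htam,
      padicValRat.mul ht0 (pow_ne_zero 2 hcard), padicValRat.pow, hcardT, ht_def,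
      padicValRat.mul hϖ0 hs0]
    simp only [padicValRat.of_nat, Nat.cast_ofNat, hv]
  refine ⟨t * (Nat.card W.toAffine.Point : ℚ) ^ 2 / (W.tamagawaProduct : ℚ), hshaAn, hq0, hfX0, hL00, ?_⟩
  rw [hvq]
  linarith

end Dictionary

/-! ## §3 At a cyclotomic datum: Kato 17.4 (1)(2) AT `2` + the dictionary -/

section Datum

open Literature.NumberTheory.EllipticCurves.Wuthrich2014
  Summit.BirchSwinnertonDyer.Rank1Residual Summit.BirchSwinnertonDyer.Rank1Residual.X5

variable (W : WeierstrassCurve ℚ) [W.IsElliptic] [W.IsGloballyMinimal]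

/-- An integral multiple `ι L₀ = ϖ·L₂(f,α)` with `ϖ ≠ 0` is non-zero (Rohrlich:
`padicLFunction_unitRoot_ne_zero`). [cite: RohrlichInventiones1984, Theorem (p. 409)] -/
theorem ne_zero_of_iwasawaToPowerSeries_eq {N : ℕ} [NeZero N] {f : CuspForm (Gamma0 N) 2}
    (hord : IsOrdinaryAt W 2) (hf : IsNewformOf W f) {ϖ : ℚ} (hϖ0 : ϖ ≠ 0) {L₀ : IwasawaAlgebra 2}
    (hL₀ : iwasawaToPowerSeries 2 L₀ =
      PowerSeries.C (ϖ : ℚ_[2]) * padicLFunction f (unitRoot W 2 : ℚ_[2])) : L₀ ≠ 0 := by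
  intro h0
  rw [h0, map_zero] at hL₀
  have hC : (PowerSeries.C (ϖ : ℚ_[2]) : PowerSeries ℚ_[2]) ≠ 0 := by
    rw [Ne, ← map_zero (PowerSeries.C (R := ℚ_[2])), PowerSeries.C_injective.eq_iff]
    exact_mod_cast hϖ0
  exact mul_ne_zero hC (padicLFunction_unitRoot_ne_zero hord hf) hL₀.symm

/-- **The three readings at a datum (PROVED core).** Rank-`0` good-ordinary-at-`2` curve, PUB
{Kato 17.4 (1)(2) AT `2` (`h17`), Greenberg 4.1 AT `2` (`hEC`), GZK}; a cyclotomic datum `D` with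
generator `f_X`, the Néron ratio `ϖ`, a non-zero rational `ϖ′` and `L₀ ∈ Λ` with `ι L₀ = ϖ′·L₂(f,α)`.
Then with `#Ш_an = q`: (i) `ord₂ #Ш + μ(L₀) + ord₂ ϖ ≤ ord₂ q + ord₂ ϖ′ + μ(X)` (Kato's direction on
the constant term); (ii) `λ(L₀) ≤ λ(X)` iff `ord₂ q + ord₂ ϖ′ + μ(X) ≤ ord₂ #Ш + μ(L₀) + ord₂ ϖ`;
(iii) `λ(X) ≤ λ(L₀)`. Mechanism: Kato pulled back to `Λ`, `(num ϖ′·a)·f_X = 2ⁿ·(den ϖ′·L₀)`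
(`MuZeroUpgrade.exists_mul_charGen_eq_of_kato_allPrimes`), §1 for `f = f_X`, `L = den ϖ′·L₀`, and §2.
[cite: Kato2004Asterisque, Thm. 17.4 (1)(2) (p. 273)] [cite: GreenbergLNM1716, Thm. 4.1 (p. 102)]
[cite: GreenbergVatsal2000, p. 4 (after Thm. (1.2))] -/
theorem sha_readings_of_kato {N : ℕ} [NeZero N] {f : CuspForm (Gamma0 N) 2}
    (h17 : kato_divisibility_allPrimes W 2 (f := f))
    (hEC : O1.TwoAdicEulerCharRankZero W 0) (hGZK : rank_eq_analyticRank_of_analyticRank_le_one)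
    (hord : IsOrdinaryAt W 2) (hL : W.entireLFunction 1 ≠ 0)
    {κ : ZpExtension ℚ 2} {γ : Field.absoluteGaloisGroup ℚ} (hκ : κ.IsCyclotomic)
    (hγ : κ.IsTopGenerator γ) (hγ' : IsCyclotomicVariable 2 γ) (hf : IsNewformOf W f)
    (D : W.SelmerDualData κ γ) {ϖ : ℚ} (hϖ : (ϖ : ℝ) * W.realPeriodRat = plusPeriod f) {ϖ' : ℚ}
    (hϖ'0 : ϖ' ≠ 0) {fX : IwasawaAlgebra 2} (hchar : D.charIdeal = Ideal.span {fX})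
    {L₀ : IwasawaAlgebra 2}
    (hL₀ : iwasawaToPowerSeries 2 L₀ =
      PowerSeries.C (ϖ' : ℚ_[2]) * padicLFunction f (unitRoot W 2 : ℚ_[2])) :
    ∃ q : ℚ, shaAn W = (q : ℂ) ∧
      ((padicValNat 2 W.shaOrder : ℤ) + mu L₀ + padicValRat 2 ϖ ≤
        padicValRat 2 q + padicValRat 2 ϖ' + D.mu) ∧
      (lam L₀ ≤ D.lambda ↔ padicValRat 2 q + padicValRat 2 ϖ' + D.mu ≤
        (padicValNat 2 W.shaOrder : ℤ) + mu L₀ + padicValRat 2 ϖ) ∧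
      D.lambda ≤ lam L₀ := by
  haveI : Module.Finite (IwasawaAlgebra 2) D.X := D.module_finite_holds hγ
  obtain ⟨hD, a, n, hkey⟩ :=
    O1.MuZeroUpgrade.exists_mul_charGen_eq_of_kato_allPrimes W 2 h17 hκ hγ hγ' hord hf D hchar hL₀
  obtain ⟨q, hq, -, hfX0, hL00, hdict⟩ :=
    exists_shaAn_eq_and_valuation_constantCoeff_charGen_eq W hEC hGZK hord hL hκ hγ hγ' hf D hD hϖ
      hϖ'0 hchar hL₀
  have hfX : fX ≠ 0 := ne_zero_of_constantCoeff_ne_zero hfX0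
  have hL₀0 : L₀ ≠ 0 := ne_zero_of_constantCoeff_ne_zero hL00
  have hlamfX : lam fX = D.lambda := lam_generator_eq_lambdaInvariant D.X hD hfX hchar
  have hmufX : mu fX = D.mu := mu_generator_eq_muInvariant D.X hD hfX hchar
  -- the setting of §1: `f_X · (num ϖ′ · a) = 2ⁿ · (den ϖ′ · L₀)`
  have hden0 : ((ϖ'.den : ℕ) : ℤ_[2]) ≠ 0 := by exact_mod_cast ϖ'.den_nz
  have h' : fX * (PowerSeries.C (ϖ'.num : ℤ_[2]) * a) =
      PowerSeries.C (((2 : ℕ) : ℤ_[2]) ^ n) * (PowerSeries.C (ϖ'.den : ℤ_[2]) * L₀) := by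
    rw [mul_comm]; exact hkey
  have hL'0 : PowerSeries.constantCoeff (PowerSeries.C (ϖ'.den : ℤ_[2]) * L₀) ≠ 0 := by
    rw [map_mul, PowerSeries.constantCoeff_C]; exact mul_ne_zero hden0 hL00
  have hvL' : (PowerSeries.constantCoeff (PowerSeries.C (ϖ'.den : ℤ_[2]) * L₀)).valuation =
      ((ϖ'.den : ℕ) : ℤ_[2]).valuation + (PowerSeries.constantCoeff L₀).valuation := by
    rw [map_mul, PowerSeries.constantCoeff_C, PadicInt.valuation_mul hden0 hL00]
  have hμL' : mu (PowerSeries.C ((ϖ'.den : ℕ) : ℤ_[2]) * L₀) =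
      ((ϖ'.den : ℕ) : ℤ_[2]).valuation + mu L₀ := by
    rw [mu_mul (fun h0 => hden0 (PowerSeries.C_injective (h0.trans (map_zero _).symm))) hL₀0,
      (LambdaConstPinch.mu_C_and_pfree_C hden0).1]
  have hlamL' : lam (PowerSeries.C ((ϖ'.den : ℕ) : ℤ_[2]) * L₀) = lam L₀ := by
    rw [lam_mul (fun h0 => hden0 (PowerSeries.C_injective (h0.trans (map_zero _).symm))) hL₀0,
      LambdaConstPinch.lam_C hden0, zero_add]
  have h1 := valuation_constantCoeff_add_mu_le h' hL'0
  have h2 := lam_eq_lam_iff_valuation_le h' hL'0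
  have h3 := lam_le_of_mul_eq_C_pow_mul h' hL'0
  rw [hvL', hμL'] at h1 h2
  rw [hlamL'] at h2 h3
  refine ⟨q, hq, ?_, ?_, by rw [← hlamfX]; exact h3⟩
  · rw [← hmufX]
    have h1' : (PowerSeries.constantCoeff fX).valuation + mu L₀ ≤
        (PowerSeries.constantCoeff L₀).valuation + mu fX := by omega
    have h1'' : ((PowerSeries.constantCoeff fX).valuation : ℤ) + mu L₀ ≤
        (PowerSeries.constantCoeff L₀).valuation + mu fX := by exact_mod_cast h1'
    linarith
  · rw [← hlamfX, ← hmufX]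
    constructor
    · intro hle
      have he : lam fX = lam L₀ := le_antisymm h3 hle
      have h2' : (PowerSeries.constantCoeff L₀).valuation + mu fX ≤
          (PowerSeries.constantCoeff fX).valuation + mu L₀ := by have := h2.mp he; omega
      have h2'' : ((PowerSeries.constantCoeff L₀).valuation : ℤ) + mu fX ≤
          (PowerSeries.constantCoeff fX).valuation + mu L₀ := by exact_mod_cast h2'
      linarith
    · intro hle
      have h2'' : ((PowerSeries.constantCoeff L₀).valuation : ℤ) + mu fX ≤
          (PowerSeries.constantCoeff fX).valuation + mu L₀ := by linarith
      have h2' : (PowerSeries.constantCoeff L₀).valuation + mu fX ≤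
          (PowerSeries.constantCoeff fX).valuation + mu L₀ := by exact_mod_cast h2''
      exact (h2.mpr (by omega)).ge

/-- **(A) Kato's rational divisibility bounds `Ш[2^∞]` from ABOVE with defect `μ(X)` (PUB only).**
Rank-`0` good-ordinary-at-`2` curve; PUB {Kato 17.4 (1)(2) AT `2`, Greenberg 4.1 AT `2`, GZK}; cyclotomic
datum `D`, Néron ratio `ϖ`, and the Néron-integral `L₀` (`ι L₀ = ϖ·L₂(f,α)`, from `0 ≤ ord₂ ϖ`). Then
`ord₂ #Ш(E) + μ(L₀) ≤ ord₂ #Ш_an(E) + μ(X(E/ℚ_∞))` — with `μ(X) = 0` this is the sharp upper half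
`MissingUpperBoundAt W 2` (`MuZeroUpgrade`), in general the loss is EXACTLY `μ(X) − μ(L₀)`.
[cite: Kato2004Asterisque, Thm. 17.4 (1)(2) (p. 273)] [cite: GreenbergLNM1716, Thm. 4.1 (p. 102)] -/
theorem padicValNat_shaOrder_add_mu_le_of_kato {N : ℕ} [NeZero N] {f : CuspForm (Gamma0 N) 2}
    (h17 : kato_divisibility_allPrimes W 2 (f := f))
    (hEC : O1.TwoAdicEulerCharRankZero W 0) (hGZK : rank_eq_analyticRank_of_analyticRank_le_one)
    (hord : IsOrdinaryAt W 2) (hL : W.entireLFunction 1 ≠ 0)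
    {κ : ZpExtension ℚ 2} {γ : Field.absoluteGaloisGroup ℚ} (hκ : κ.IsCyclotomic)
    (hγ : κ.IsTopGenerator γ) (hγ' : IsCyclotomicVariable 2 γ) (hf : IsNewformOf W f)
    (D : W.SelmerDualData κ γ) {ϖ : ℚ} (hϖ : (ϖ : ℝ) * W.realPeriodRat = plusPeriod f)
    {L₀ : IwasawaAlgebra 2}
    (hL₀ : iwasawaToPowerSeries 2 L₀ =
      PowerSeries.C (ϖ : ℚ_[2]) * padicLFunction f (unitRoot W 2 : ℚ_[2])) :
    ∃ q : ℚ, shaAn W = (q : ℂ) ∧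
      (padicValNat 2 W.shaOrder : ℤ) + mu L₀ ≤ padicValRat 2 q + D.mu := by
  have hϖ0 : ϖ ≠ 0 := X2.varpi_ne_zero_of_isNewformOf hf hϖ
  obtain ⟨fX, hfX⟩ := (charIdeal_isPrincipal_holds 2 D.X).principal
  obtain ⟨q, hq, h1, -, -⟩ :=
    sha_readings_of_kato W h17 hEC hGZK hord hL hκ hγ hγ' hf D hϖ hϖ0 hfX hL₀
  exact ⟨q, hq, by linarith⟩

end Datum

end Summit.BirchSwinnertonDyer.BirchSwinnertonDyer.Theorems.EisensteinShaCurrency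

end
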